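import Summits.ResolutionOfSingularities.ResolutionOfSingularities.Theorems.FrobeniusLadderFInjectiveMacaulayficationGenericFibreLocalization
import Summits.ResolutionOfSingularities.ResolutionOfSingularities.Theorems.FrobeniusLadderFInjectiveMacaulayficationGenericFibreTopology
import Summits.ResolutionOfSingularities.ResolutionOfSingularities.Theorems.FrobeniusLadderFInjectiveMacaulayficationFiLocusOpenOfAffine
import Summits.ResolutionOfSingularities.ResolutionOfSingularities.Theorems.FrobeniusLadderFInjectiveMacaulayficationPointCentreIdealSheaf
import Mathlib.RingTheory.Localization.LocalizationLocalization
import Mathlib.AlgebraicGeometry.Noetherian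
import HarnessLib

/-!
# The generic-fibre model: an admissible scheme over `K₀ = k(t)` whose only bad point is a CLOSED point with the local ring of `η` —
# U16 = §G0b `genericFibreModel` of `GenericFibreSig` (crux `FInjectiveMacaulayfication` stmt-ResolutionOfSingularities-15315, chain w45a)

[OURS · L1 W4.5a · res-D-pv-019 AS res-L1-w45a-stub-7] Support file (`--supports stmt-ResolutionOfSingularities-15315 --as helper`)
for the crux `FrobeniusLadder.FInjectiveMacaulayfication`; NOT a statement of any manuscript; AI-written, weaker than expert review.
Statement = §G0b `stub_genericFibreModel` of strat-1's `L/res-L1-w45a-strat-1/GenericFibreSig.lean` (sha16 5323a437c3c0f1a3,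
evidence #43 on 15315) VERBATIM with `stub_` dropped (plan-1 R12.57 (1): U16 := stub-7).

THE THEOREM (`genericFibreModel`). `(X₁, f₁)` locally of finite type over a field `k` of characteristic `p`, integral, all stalks
Cohen–Macaulay, with OPEN good locus (the text of #2's conclusion), and `η` a bad point all of whose proper generizations are good.
Then there are a field `K₀` of characteristic `p` and an ADMISSIBLE `(X₀, f₀ : X₀ ⟶ Spec K₀)` (separated, locally of finite type,
quasi-compact, integral, Cohen–Macaulay stalks) with FINITE bad locus and a CLOSED bad point `b` with `𝒪_{X₀,b} ≃+* 𝒪_{X₁,η}`.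
CONSTRUCTION. An affine open `U ∋ η` with `bad ∩ U ⊆ closure {η}` (`GenericFibreTopology.exists_affineOpen_inter_subset_closure`:
the bad locus is closed and `η` is maximal in it); `A = Γ(X₁, U)` is a finite-type `k`-domain
(`FiLocusOpenOfAffine.finiteType_sections`), `𝔭` the prime of `η`; `(M, K₀)` from U15
`GenericFibreLocalization.genericFibreLocalization` (p526415): `M ∩ 𝔭 = ∅`, `𝔭·A[M⁻¹]` maximal, `A[M⁻¹]` of finite type over the
field `K₀ ⊇ k`. `X₀ := Spec A[M⁻¹] ⟶ Spec K₀` is affine (separated, quasi-compact), of finite type, integral (`A[M⁻¹] ⊆ Frac A`),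
`char K₀ = p` (`k ⊆ K₀`). STALKS: `𝒪_{X₀,𝔮'} ≅ A[M⁻¹]_{𝔮'} ≅ A_𝔮 ≅ 𝒪_{X₁,x}` for `𝔮 = 𝔮' ∩ A` and `x ∈ U` the point of `𝔮`
(`Spec.stalkIso`, `IsLocalization.localizationLocalizationAtPrimeIsoLocalization`, `IsAffineOpen.isLocalization_stalk'`): so every
stalk of `X₀` is Cohen–Macaulay, and a bad `𝔮'` gives a bad `x ∈ U`, hence `x ∈ closure {η}`, `𝔭 ⊆ 𝔮`, `𝔮' ⊇ 𝔭·A[M⁻¹]` maximal: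
`𝔮' = b := 𝔭·A[M⁻¹]`. So the bad locus of `X₀` is `⊆ {b}`, `b` is closed (maximal), and `𝒪_{X₀,b} ≅ 𝒪_{X₁,η}` (the point of
`b ∩ A = 𝔭` is `η`), whence `b` is bad. No named facts.
-/

-- single-problem summit: the doubled namespace component is forced
set_option linter.dupNamespace false

noncomputable section

open AlgebraicGeometry CategoryTheory TopologicalSpace IsLocalRing Topology

namespace Summit.ResolutionOfSingularities.ResolutionOfSingularities.Theorems.FInjectiveMacaulayfication.GenericFibreModel

open Summit.ResolutionOfSingularities.ResolutionOfSingularities.Theorems.FInjectiveMacaulayfication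

/-- **U16 / §G0b — THE GENERIC-FIBRE MODEL** (`GenericFibreSig` §G0b `stub_genericFibreModel`, verbatim). See the module
docstring for the construction `X₀ = Spec Γ(X₁,U)[M⁻¹] ⟶ Spec K₀`. [folklore] -/
theorem genericFibreModel : ∀ (p : ℕ), p.Prime → ∀ (k : Type) [Field k] [CharP k p]
    (X₁ : Scheme.{0}) (f₁ : X₁ ⟶ Spec (.of k)), LocallyOfFiniteType f₁ → IsIntegral X₁ →
      (∀ x : X₁, ∀ d : ℕ, ringKrullDim (X₁.presheaf.stalk x) = d → ∀ s : Fin d → X₁.presheaf.stalk x,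
        (Ideal.span (Set.range s)).radical.IsMaximal → RingTheory.Sequence.IsWeaklyRegular (X₁.presheaf.stalk x) (List.ofFn s)) →
      IsOpen {x : X₁ | ∀ d : ℕ, ringKrullDim (X₁.presheaf.stalk x) = d →
        ∀ s : Fin d → X₁.presheaf.stalk x, (Ideal.span (Set.range s)).radical.IsMaximal →
          ∀ y : X₁.presheaf.stalk x, (∃ e : ℕ, y ^ p ^ e ∈
            Ideal.span ((fun z : X₁.presheaf.stalk x => z ^ p ^ e) ''
              (Ideal.span (Set.range s) : Set (X₁.presheaf.stalk x)))) → y ∈ Ideal.span (Set.range s)} →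
      ∀ η : X₁, (¬ (∀ d : ℕ, ringKrullDim (X₁.presheaf.stalk η) = d → ∀ s : Fin d → X₁.presheaf.stalk η,
          (Ideal.span (Set.range s)).radical.IsMaximal → ∀ t : X₁.presheaf.stalk η, (∃ e : ℕ, t ^ p ^ e ∈
            Ideal.span ((fun z : X₁.presheaf.stalk η => z ^ p ^ e) '' (Ideal.span (Set.range s) : Set (X₁.presheaf.stalk η)))) →
              t ∈ Ideal.span (Set.range s))) →
        (∀ y : X₁, y ⤳ η → y ≠ η → (∀ d : ℕ, ringKrullDim (X₁.presheaf.stalk y) = d → ∀ s : Fin d → X₁.presheaf.stalk y,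
          (Ideal.span (Set.range s)).radical.IsMaximal → ∀ t : X₁.presheaf.stalk y, (∃ e : ℕ, t ^ p ^ e ∈
            Ideal.span ((fun z : X₁.presheaf.stalk y => z ^ p ^ e) '' (Ideal.span (Set.range s) : Set (X₁.presheaf.stalk y)))) →
              t ∈ Ideal.span (Set.range s))) →
      ∃ (K₀ : Type) (_ : Field K₀) (_ : CharP K₀ p) (X₀ : Scheme.{0}) (f₀ : X₀ ⟶ Spec (.of K₀)),
        IsSeparated f₀ ∧ LocallyOfFiniteType f₀ ∧ QuasiCompact f₀ ∧ IsIntegral X₀ ∧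
        (∀ x : X₀, ∀ d : ℕ, ringKrullDim (X₀.presheaf.stalk x) = d → ∀ s : Fin d → X₀.presheaf.stalk x,
          (Ideal.span (Set.range s)).radical.IsMaximal → RingTheory.Sequence.IsWeaklyRegular (X₀.presheaf.stalk x) (List.ofFn s)) ∧
        Set.Finite {x : X₀ | ¬ ∀ d : ℕ, ringKrullDim (X₀.presheaf.stalk x) = d → ∀ s : Fin d → X₀.presheaf.stalk x,
          (Ideal.span (Set.range s)).radical.IsMaximal → ∀ y : X₀.presheaf.stalk x, (∃ e : ℕ, y ^ p ^ e ∈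
            Ideal.span ((fun z : X₀.presheaf.stalk x => z ^ p ^ e) '' (Ideal.span (Set.range s) : Set (X₀.presheaf.stalk x)))) →
              y ∈ Ideal.span (Set.range s)} ∧
        ∃ b : X₀, IsClosed ({b} : Set X₀) ∧
          (¬ ∀ d : ℕ, ringKrullDim (X₀.presheaf.stalk b) = d → ∀ s : Fin d → X₀.presheaf.stalk b,
            (Ideal.span (Set.range s)).radical.IsMaximal → ∀ y : X₀.presheaf.stalk b, (∃ e : ℕ, y ^ p ^ e ∈
              Ideal.span ((fun z : X₀.presheaf.stalk b => z ^ p ^ e) '' (Ideal.span (Set.range s) : Set (X₀.presheaf.stalk b)))) →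
                y ∈ Ideal.span (Set.range s)) ∧
          Nonempty (X₀.presheaf.stalk b ≃+* X₁.presheaf.stalk η)  := by
  intro p hp k _ _ X₁ f₁ hft hint hCM hopen η hηbad hgen
  classical
  haveI := hft
  haveI : IsLocallyNoetherian X₁ := LocallyOfFiniteType.isLocallyNoetherian f₁
  -- Step 1: an affine open `U ∋ η` on which the (closed) bad locus lies in `closure {η}`
  have hC : IsClosed {x : X₁ | ¬ ∀ d : ℕ, ringKrullDim (X₁.presheaf.stalk x) = d → ∀ s : Fin d → X₁.presheaf.stalk x, (Ideal.span (Set.range s)).radical.IsMaximal → ∀ y : X₁.presheaf.stalk x, (∃ e : ℕ, y ^ p ^ e ∈ Ideal.span ((fun z : X₁.presheaf.stalk x => z ^ p ^ e) '' (Ideal.span (Set.range s) : Set (X₁.presheaf.stalk x)))) → y ∈ Ideal.span (Set.range s)} := by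
    rw [← isOpen_compl_iff]
    convert hopen using 1
    ext x
    simp only [Set.mem_compl_iff, Set.mem_setOf_eq, not_not]
  obtain ⟨U, hηU, hCU⟩ := GenericFibreTopology.exists_affineOpen_inter_subset_closure X₁ hC η
    (fun ξ h₁ h₂ h₃ => h₃ (hgen ξ h₁ h₂))
  -- Step 2: `A = Γ(X₁, U)`, a finite-type `k`-domain; the prime `𝔭` of `η`; the generic-fibre localisation (U15)
  haveI : Nonempty (U : X₁.Opens) := ⟨⟨η, hηU⟩⟩
  obtain ⟨instAlg, hftA⟩ := FiLocusOpenOfAffine.finiteType_sections k f₁ U.2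
  obtain ⟨M, hdisj, hmax, K₀, instF, instk, instK, hftK⟩ := GenericFibreLocalization.genericFibreLocalization k Γ(X₁, U) hftA
    (U.2.primeIdealOf ⟨η, hηU⟩).asIdeal inferInstance
  have hM0 : M ≤ nonZeroDivisors Γ(X₁, U) :=
    le_nonZeroDivisors_of_noZeroDivisors fun h0 => Set.disjoint_left.mp hdisj h0 (Ideal.zero_mem _)
  haveI : IsDomain (Localization M) := IsLocalization.isDomain_localization hM0
  haveI : CharP K₀ p := charP_of_injective_algebraMap (algebraMap k K₀).injective p
  -- Step 3: the stalk dictionary `𝒪_{X₀,𝔮'} ≅ 𝒪_{X₁,x}`, `x ∈ U` the point of `𝔮' ∩ A`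
  have key : ∀ x₀ : Spec (.of (Localization M)),
      ∃ hy : U.2.fromSpec ⟨x₀.asIdeal.comap (algebraMap Γ(X₁, U) (Localization M)), inferInstance⟩ ∈ (U : X₁.Opens),
        U.2.primeIdealOf ⟨_, hy⟩ = ⟨x₀.asIdeal.comap (algebraMap Γ(X₁, U) (Localization M)), inferInstance⟩ ∧
        Nonempty ((Spec (.of (Localization M))).presheaf.stalk x₀ ≃+*
          X₁.presheaf.stalk (U.2.fromSpec ⟨x₀.asIdeal.comap (algebraMap Γ(X₁, U) (Localization M)), inferInstance⟩)) := by
    intro x₀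
    have hy := PointCentreIdealSheaf.fromSpec_mem U.2 ⟨x₀.asIdeal.comap (algebraMap Γ(X₁, U) (Localization M)), inferInstance⟩
    refine ⟨hy, PointCentreIdealSheaf.primeIdealOf_fromSpec U.2 _ hy, ⟨?_⟩⟩
    letI := TopCat.Presheaf.algebra_section_stalk X₁.presheaf
      ⟨U.2.fromSpec ⟨x₀.asIdeal.comap (algebraMap Γ(X₁, U) (Localization M)), inferInstance⟩, hy⟩
    haveI : IsLocalization.AtPrime
        (X₁.presheaf.stalk (U.2.fromSpec ⟨x₀.asIdeal.comap (algebraMap Γ(X₁, U) (Localization M)), inferInstance⟩))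
        (x₀.asIdeal.comap (algebraMap Γ(X₁, U) (Localization M))) :=
      U.2.isLocalization_stalk' ⟨x₀.asIdeal.comap (algebraMap Γ(X₁, U) (Localization M)), inferInstance⟩ hy
    exact (Spec.stalkIso (.of (Localization M)) x₀).commRingCatIsoToRingEquiv.trans
      ((IsLocalization.localizationLocalizationAtPrimeIsoLocalization M x₀.asIdeal).symm.toRingEquiv.trans
        (IsLocalization.algEquiv (x₀.asIdeal.comap (algebraMap Γ(X₁, U) (Localization M))).primeCompl
          (Localization.AtPrime (x₀.asIdeal.comap (algebraMap Γ(X₁, U) (Localization M))))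
          (X₁.presheaf.stalk (U.2.fromSpec ⟨x₀.asIdeal.comap (algebraMap Γ(X₁, U) (Localization M)),
            inferInstance⟩))).toRingEquiv)
  -- Cohen–Macaulayness of every stalk of `X₀`
  have hCM₀ : ∀ x₀ : Spec (.of (Localization M)), ∀ d : ℕ, ringKrullDim ((Spec (.of (Localization M))).presheaf.stalk x₀) = d → ∀ s : Fin d → (Spec (.of (Localization M))).presheaf.stalk x₀, (Ideal.span (Set.range s)).radical.IsMaximal → RingTheory.Sequence.IsWeaklyRegular ((Spec (.of (Localization M))).presheaf.stalk x₀) (List.ofFn s) := by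
    intro x₀
    obtain ⟨hy, -, ⟨e⟩⟩ := key x₀
    exact FiLocusOpenOfAffine.cmClause_of_ringEquiv e.symm (hCM _)
  -- the point `b = 𝔭·A[M⁻¹]` and its identification with `η`
  let b : Spec (.of (Localization M)) :=
    ⟨(U.2.primeIdealOf ⟨η, hηU⟩).asIdeal.map (algebraMap Γ(X₁, U) (Localization M)), hmax.isPrime⟩
  have hbcomap : b.asIdeal.comap (algebraMap Γ(X₁, U) (Localization M)) = (U.2.primeIdealOf ⟨η, hηU⟩).asIdeal :=
    IsLocalization.under_map_of_isPrime_disjoint M (Localization M)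
      (inferInstance : (U.2.primeIdealOf ⟨η, hηU⟩).asIdeal.IsPrime) hdisj
  have hηeq : U.2.fromSpec ⟨b.asIdeal.comap (algebraMap Γ(X₁, U) (Localization M)), inferInstance⟩ = η := by
    have : (⟨b.asIdeal.comap (algebraMap Γ(X₁, U) (Localization M)), inferInstance⟩ : PrimeSpectrum Γ(X₁, U)) =
        U.2.primeIdealOf ⟨η, hηU⟩ := PrimeSpectrum.ext hbcomap
    rw [this]
    exact U.2.fromSpec_primeIdealOf ⟨η, hηU⟩
  -- the bad points of `X₀` are all equal to `b`
  have hbad : ∀ x₀ : Spec (.of (Localization M)), ¬ (∀ d : ℕ, ringKrullDim ((Spec (.of (Localization M))).presheaf.stalk x₀) = d → ∀ s : Fin d → (Spec (.of (Localization M))).presheaf.stalk x₀, (Ideal.span (Set.range s)).radical.IsMaximal → ∀ y : (Spec (.of (Localization M))).presheaf.stalk x₀, (∃ e : ℕ, y ^ p ^ e ∈ Ideal.span ((fun z : (Spec (.of (Localization M))).presheaf.stalk x₀ => z ^ p ^ e) '' (Ideal.span (Set.range s) : Set ((Spec (.of (Localization M))).presheaf.stalk x₀)))) → y ∈ Ideal.span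 (Set.range s)) → x₀ = b := by
    intro x₀ hx₀
    obtain ⟨hy, hprime, ⟨e⟩⟩ := key x₀
    -- the corresponding point of `U` is bad, hence in `closure {η}`
    have hxbad : ¬ (∀ d : ℕ, ringKrullDim (X₁.presheaf.stalk (U.2.fromSpec ⟨x₀.asIdeal.comap (algebraMap Γ(X₁, U) (Localization M)), inferInstance⟩)) = d → ∀ s : Fin d → X₁.presheaf.stalk (U.2.fromSpec ⟨x₀.asIdeal.comap (algebraMap Γ(X₁, U) (Localization M)), inferInstance⟩), (Ideal.span (Set.range s)).radical.IsMaximal → ∀ y : X₁.presheaf.stalk (U.2.fromSpec ⟨x₀.asIdeal.comap (algebraMap Γ(X₁, U) (Localization M)), inferInstance⟩), (∃ e : ℕ, y ^ p ^ e ∈ Ideal.span ((fun z : X₁.presheaf.stalk (U.2.fromSpec ⟨x₀.asIdeal.comap (algebraMap Γ(X₁, U) (Localization M)), inferInstance⟩) => z ^ p ^ e) '' (Ideal.span (Set.range s) : Set (X₁.presheaf.stalk (U.2.fromSpec ⟨x₀.asIdeal.comap (algebraMap Γ(X₁, U) (Localization M)), inferInstance⟩))))) → y ∈ Ideal.span (Set.range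 s)) := fun hF => hx₀ (FiLocusOpenOfAffine.fClause_of_ringEquiv p e.symm hF)
    have hxcl := hCU ⟨hxbad, hy⟩
    have hspec : η ⤳ U.2.fromSpec ⟨x₀.asIdeal.comap (algebraMap Γ(X₁, U) (Localization M)), inferInstance⟩ :=
      specializes_iff_mem_closure.mpr hxcl
    -- inside `U`, hence on primes: `𝔭 ≤ 𝔮' ∩ A`
    have hspecU : (⟨η, hηU⟩ : (U : X₁.Opens)) ⤳ ⟨_, hy⟩ := IsInducing.subtypeVal.specializes_iff.mp hspec
    have hle : (U.2.primeIdealOf ⟨η, hηU⟩).asIdeal ≤ x₀.asIdeal.comap (algebraMap Γ(X₁, U) (Localization M)) := by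
      have h := (PrimeSpectrum.le_iff_specializes (U.2.primeIdealOf ⟨η, hηU⟩) (U.2.primeIdealOf ⟨_, hy⟩)).mpr
        (hspecU.map U.2.isoSpec.hom.continuous)
      rw [hprime] at h
      exact h
    -- maximality of `𝔭·A[M⁻¹]`
    apply PrimeSpectrum.ext
    exact (hmax.eq_of_le x₀.2.ne_top (Ideal.map_le_iff_le_comap.mpr hle)).symm
  -- Step 4: assemble
  refine ⟨K₀, instF, inferInstance, Spec (.of (Localization M)), Spec.map (CommRingCat.ofHom (algebraMap K₀ (Localization M))),
    inferInstance, ?_, inferInstance, inferInstance, hCM₀, ?_, b, ?_, ?_, ?_⟩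
  · exact (HasRingHomProperty.Spec_iff (P := @LocallyOfFiniteType)).mpr (RingHom.finiteType_algebraMap.mpr hftK)
  · exact (Set.finite_singleton b).subset fun x₀ hx₀ => Set.mem_singleton_iff.mpr (hbad x₀ hx₀)
  · exact (PrimeSpectrum.isClosed_singleton_iff_isMaximal b).mpr hmax
  · obtain ⟨hy, -, ⟨e⟩⟩ := key b
    intro hF
    apply hηbad
    have h := FiLocusOpenOfAffine.fClause_of_ringEquiv p e hF
    rwa [hηeq] at h
  · obtain ⟨hy, -, ⟨e⟩⟩ := key b
    rw [← hηeq]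
    exact ⟨e⟩

/-- **The generic-fibre model at an ARBITRARY point** (no badness hypotheses): for `(X₁, f₁)` locally of finite type over a field
`k` of characteristic `p`, integral with Cohen–Macaulay stalks, and ANY point `η`, there are a field `K₀` of characteristic `p`, an
admissible `(X₀, f₀ : X₀ ⟶ Spec K₀)` (separated, locally of finite type, quasi-compact, integral, Cohen–Macaulay stalks) and a
CLOSED point `b ∈ X₀` with `𝒪_{X₀,b} ≃+* 𝒪_{X₁,η}` — the same construction on any affine open around `η` (the form consumed by
`EnlargeFullOpenSig` §F1 `relPointFix_anyPoint`). [folklore] -/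
theorem exists_model_closedPoint : ∀ (p : ℕ), p.Prime → ∀ (k : Type) [Field k] [CharP k p]
    (X₁ : Scheme.{0}) (f₁ : X₁ ⟶ Spec (.of k)), LocallyOfFiniteType f₁ → IsIntegral X₁ →
      (∀ x : X₁, ∀ d : ℕ, ringKrullDim (X₁.presheaf.stalk x) = d → ∀ s : Fin d → X₁.presheaf.stalk x,
        (Ideal.span (Set.range s)).radical.IsMaximal → RingTheory.Sequence.IsWeaklyRegular (X₁.presheaf.stalk x) (List.ofFn s)) →
      ∀ η : X₁, ∃ (K₀ : Type) (_ : Field K₀) (_ : CharP K₀ p) (X₀ : Scheme.{0}) (f₀ : X₀ ⟶ Spec (.of K₀)),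
        IsSeparated f₀ ∧ LocallyOfFiniteType f₀ ∧ QuasiCompact f₀ ∧ IsIntegral X₀ ∧
        (∀ x : X₀, ∀ d : ℕ, ringKrullDim (X₀.presheaf.stalk x) = d → ∀ s : Fin d → X₀.presheaf.stalk x,
          (Ideal.span (Set.range s)).radical.IsMaximal → RingTheory.Sequence.IsWeaklyRegular (X₀.presheaf.stalk x) (List.ofFn s)) ∧
        ∃ b : X₀, IsClosed ({b} : Set X₀) ∧ Nonempty (X₀.presheaf.stalk b ≃+* X₁.presheaf.stalk η) := by
  intro p hp k _ _ X₁ f₁ hft hint hCM η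
  classical
  haveI := hft
  haveI : IsLocallyNoetherian X₁ := LocallyOfFiniteType.isLocallyNoetherian f₁
  obtain ⟨U₀, hU₀, hηU, -⟩ := exists_isAffineOpen_mem_and_subset (X := X₁) (x := η) (U := ⊤) (Opens.mem_top η)
  let U : X₁.affineOpens := ⟨U₀, hU₀⟩
  haveI : Nonempty (U : X₁.Opens) := ⟨⟨η, hηU⟩⟩
  obtain ⟨instAlg, hftA⟩ := FiLocusOpenOfAffine.finiteType_sections k f₁ U.2
  obtain ⟨M, hdisj, hmax, K₀, instF, instk, instK, hftK⟩ := GenericFibreLocalization.genericFibreLocalization k Γ(X₁, U) hftA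
    (U.2.primeIdealOf ⟨η, hηU⟩).asIdeal inferInstance
  have hM0 : M ≤ nonZeroDivisors Γ(X₁, U) :=
    le_nonZeroDivisors_of_noZeroDivisors fun h0 => Set.disjoint_left.mp hdisj h0 (Ideal.zero_mem _)
  haveI : IsDomain (Localization M) := IsLocalization.isDomain_localization hM0
  haveI : CharP K₀ p := charP_of_injective_algebraMap (algebraMap k K₀).injective p
  -- stalk dictionary, as in `genericFibreModel`
  have key : ∀ x₀ : Spec (.of (Localization M)),
      ∃ hy : U.2.fromSpec ⟨x₀.asIdeal.comap (algebraMap Γ(X₁, U) (Localization M)), inferInstance⟩ ∈ (U : X₁.Opens),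
        Nonempty ((Spec (.of (Localization M))).presheaf.stalk x₀ ≃+*
          X₁.presheaf.stalk (U.2.fromSpec ⟨x₀.asIdeal.comap (algebraMap Γ(X₁, U) (Localization M)), inferInstance⟩)) := by
    intro x₀
    have hy := PointCentreIdealSheaf.fromSpec_mem U.2 ⟨x₀.asIdeal.comap (algebraMap Γ(X₁, U) (Localization M)), inferInstance⟩
    refine ⟨hy, ⟨?_⟩⟩
    letI := TopCat.Presheaf.algebra_section_stalk X₁.presheaf
      ⟨U.2.fromSpec ⟨x₀.asIdeal.comap (algebraMap Γ(X₁, U) (Localization M)), inferInstance⟩, hy⟩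
    haveI : IsLocalization.AtPrime
        (X₁.presheaf.stalk (U.2.fromSpec ⟨x₀.asIdeal.comap (algebraMap Γ(X₁, U) (Localization M)), inferInstance⟩))
        (x₀.asIdeal.comap (algebraMap Γ(X₁, U) (Localization M))) :=
      U.2.isLocalization_stalk' ⟨x₀.asIdeal.comap (algebraMap Γ(X₁, U) (Localization M)), inferInstance⟩ hy
    exact (Spec.stalkIso (.of (Localization M)) x₀).commRingCatIsoToRingEquiv.trans
      ((IsLocalization.localizationLocalizationAtPrimeIsoLocalization M x₀.asIdeal).symm.toRingEquiv.trans
        (IsLocalization.algEquiv (x₀.asIdeal.comap (algebraMap Γ(X₁, U) (Localization M))).primeCompl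
          (Localization.AtPrime (x₀.asIdeal.comap (algebraMap Γ(X₁, U) (Localization M))))
          (X₁.presheaf.stalk (U.2.fromSpec ⟨x₀.asIdeal.comap (algebraMap Γ(X₁, U) (Localization M)),
            inferInstance⟩))).toRingEquiv)
  have hCM₀ : ∀ x₀ : Spec (.of (Localization M)), ∀ d : ℕ, ringKrullDim ((Spec (.of (Localization M))).presheaf.stalk x₀) = d → ∀ s : Fin d → (Spec (.of (Localization M))).presheaf.stalk x₀, (Ideal.span (Set.range s)).radical.IsMaximal → RingTheory.Sequence.IsWeaklyRegular ((Spec (.of (Localization M))).presheaf.stalk x₀) (List.ofFn s) := by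
    intro x₀
    obtain ⟨hy, ⟨e⟩⟩ := key x₀
    exact FiLocusOpenOfAffine.cmClause_of_ringEquiv e.symm (hCM _)
  let b : Spec (.of (Localization M)) :=
    ⟨(U.2.primeIdealOf ⟨η, hηU⟩).asIdeal.map (algebraMap Γ(X₁, U) (Localization M)), hmax.isPrime⟩
  have hbcomap : b.asIdeal.comap (algebraMap Γ(X₁, U) (Localization M)) = (U.2.primeIdealOf ⟨η, hηU⟩).asIdeal :=
    IsLocalization.under_map_of_isPrime_disjoint M (Localization M)
      (inferInstance : (U.2.primeIdealOf ⟨η, hηU⟩).asIdeal.IsPrime) hdisj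
  have hηeq : U.2.fromSpec ⟨b.asIdeal.comap (algebraMap Γ(X₁, U) (Localization M)), inferInstance⟩ = η := by
    have : (⟨b.asIdeal.comap (algebraMap Γ(X₁, U) (Localization M)), inferInstance⟩ : PrimeSpectrum Γ(X₁, U)) =
        U.2.primeIdealOf ⟨η, hηU⟩ := PrimeSpectrum.ext hbcomap
    rw [this]
    exact U.2.fromSpec_primeIdealOf ⟨η, hηU⟩
  refine ⟨K₀, instF, inferInstance, Spec (.of (Localization M)), Spec.map (CommRingCat.ofHom (algebraMap K₀ (Localization M))),
    inferInstance, ?_, inferInstance, inferInstance, hCM₀, b, ?_, ?_⟩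
  · exact (HasRingHomProperty.Spec_iff (P := @LocallyOfFiniteType)).mpr (RingHom.finiteType_algebraMap.mpr hftK)
  · exact (PrimeSpectrum.isClosed_singleton_iff_isMaximal b).mpr hmax
  · obtain ⟨hy, ⟨e⟩⟩ := key b
    rw [← hηeq]
    exact ⟨e⟩

end Summit.ResolutionOfSingularities.ResolutionOfSingularities.Theorems.FInjectiveMacaulayfication.GenericFibreModel

end
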